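import Summits.AtomisticToContinuum.HydrodynamicLimit.Theses.AntiMazurCoboundaries

/-!
# Sketch — crux idea `rare-band-residence-ladder` (crux KineticWindowGronwall, stmt-AtomisticToContinuum-9282;
crux-ideate round 1, ideator 2, gen 2)

First checkable statements of the line, typed over existing declarations (they elaborate; nothing is proved
here — `RareBandLdDecay` is the new open lemma of the line, `AmplitudeLadder` the provable-grade glue).

* `RareBandLdDecay` — the RARE HALF of the quadratic class: kinetic-window LD decay (same frame, same
  quantifier shape, same window `h = τ (N+1)^{-1/3}` and same invariant law `G_N = localGibbsLaw σ a u₀ θ` as the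
  shared hypothesis `KineticFluxLdDecay`, stmt-10967) for continuous fast one-body observables `g` that VANISH on
  the bulk `‖w‖ ≤ V₁` and grow at most quadratically, `|g w| ≤ c⋆ ‖w‖²`, at the amplitude `c⋆` itself (no `κ`):
  the amplitude the window Gronwall of 9282 needs on the velocity bands `(κA)^{1/3} < ‖w‖ ≤ A` of the truncated
  heat current and which the bounded-class hypothesis cannot reach.
* `QuadraticClassLdDecay` — the full quadratic class (Nachtergaele–Yau's currency: truncated currents
  `≤ M·(energy)`, Gronwall constant `δ⁻¹ M`, tails `e^{-cM²}`).
* `AmplitudeLadder` — `KineticFluxLdDecay → RareBandLdDecay → QuadraticClassLdDecay` (one Cauchy–Schwarz on the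
  window exponential moment after splitting `g = g χ_{V₁} + g (1 - χ_{V₁})` and re-orthogonalising each piece to
  the collision invariants; the collision-invariant remainders are conserved-field functionals bounded statically).
* `RareBandSlaving` — `KineticFluxLdDecay → RareBandLdDecay` (the line's bet: the rare half is slaved to the
  bounded class by fast-packet averaging + tail slaving), and `quadraticClass_of_bounded` (logic).
-/

namespace Summit.AtomisticToContinuum.HydrodynamicLimit.Cruxes.KineticWindowGronwall.RareBandResidenceLadder

open scoped BigOperators
open MeasureTheory
open Summit.AtomisticToContinuum.HydrodynamicLimit.Theses.AntiMazurCoboundaries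

/-- **Rare-band LD decay** (the new lemma of the line). Frame of `KineticFluxLdDecay` verbatim, with the
amplitude clause `∃ κ, … |g v| ≤ κ` replaced by: `∃ c⋆ > 0, ∃ V₁ > 0` such that for all continuous `φ, g` with
`|φ| ≤ 1`, `|g w| ≤ c⋆ ‖w‖²`, `g w = 0` whenever `‖w‖ ≤ V₁`, and `g ⊥ span(1, w, ‖w‖²)` in `L²(stdGaussian)`:
`∀ δ > 0 ∃ τ, N₀ ∀ N ≥ N₀ ∀ Φ: ∫ exp(h⁻¹ ∫₀ʰ Σᵢ φ(xᵢ(s)) g((vᵢ(s) − u₀)/√θ) ds) dG_N ≤ e^{δ(N+1)}`,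
`h = τ (N+1)^{-1/3}`. Finite statically for `c⋆ < 1/2` (Gaussian class); the content is the DECAY in `τ`, whose
mechanism is the residence-time (Rayleigh/Lanford) regime of fast packets: a packet of speed `V ≥ V₁` leaves
each dyadic band after `O(1)` of ITS OWN collisions, i.e. after a bulk time `O(ℓ_mf/V)` during which the bulk is
free to relative order `v_th/V` — the expansion parameter is `1/V`, not the density. -/
def RareBandLdDecay : Prop :=
  ∀ (a θ : ℝ) (u₀ : Literature.MathematicalPhysics.KineticTheory.V3), 0 < a → 0 < θ → ∃ σ₀ : ℝ, 0 < σ₀ ∧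
    ∀ σ : ℝ, 0 < σ → σ < σ₀ →
    (∀ (N : ℕ) (Φ : Literature.Analysis.FluidPDE.HardSphereFlow (Literature.Analysis.FluidPDE.Torus.geometry (Fin 3))
        (Literature.MathematicalPhysics.KineticTheory.hsDiameter σ N) (N + 1)),
      MeasureTheory.IsProbabilityMeasure
        (Literature.MathematicalPhysics.KineticTheory.localGibbsLaw σ (fun _ => a) (fun _ => u₀) (fun _ => θ) N Φ)) ∧
    ∃ cstar : ℝ, 0 < cstar ∧ ∃ V₁ : ℝ, 0 < V₁ ∧
    ∀ (φ : Literature.MathematicalPhysics.KineticTheory.T3 → ℝ) (g : Literature.MathematicalPhysics.KineticTheory.V3 → ℝ),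
      Continuous φ → Continuous g → (∀ x, |φ x| ≤ 1) → (∀ v, |g v| ≤ cstar * ‖v‖ ^ 2) →
      (∀ v, ‖v‖ ≤ V₁ → g v = 0) →
      (∀ (c₀ c₂ : ℝ) (b : Literature.MathematicalPhysics.KineticTheory.V3),
        ∫ v, g v * (c₀ + inner ℝ b v + c₂ * ‖v‖ ^ 2) ∂(ProbabilityTheory.stdGaussian Literature.MathematicalPhysics.KineticTheory.V3) = 0) →
      ∀ δ : ℝ, 0 < δ → ∃ τ : ℝ, 0 < τ ∧ ∃ N₀ : ℕ, ∀ N : ℕ, N₀ ≤ N →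
      ∀ Φ : Literature.Analysis.FluidPDE.HardSphereFlow (Literature.Analysis.FluidPDE.Torus.geometry (Fin 3))
          (Literature.MathematicalPhysics.KineticTheory.hsDiameter σ N) (N + 1),
        ∫⁻ z, ENNReal.ofReal (Real.exp ((τ * ((N + 1 : ℕ) : ℝ) ^ (-(1 / 3 : ℝ)))⁻¹ *
            ∫ s in (0 : ℝ)..(τ * ((N + 1 : ℕ) : ℝ) ^ (-(1 / 3 : ℝ))),
              ∑ i, φ (Φ.flow s z i).1 * g ((Real.sqrt θ)⁻¹ • ((Φ.flow s z i).2 - u₀))))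
          ∂(Literature.MathematicalPhysics.KineticTheory.localGibbsLaw σ (fun _ => a) (fun _ => u₀) (fun _ => θ) N Φ)
        ≤ ENNReal.ofReal (Real.exp (δ * (N + 1)))

/-- **Quadratic-class LD decay** (`A_quad`, the strengthening of `KineticFluxLdDecay` the window Gronwall
actually consumes — Nachtergaele–Yau 2003 Lemma 5.1 / Thm 7.1 bookkeeping): as `KineticFluxLdDecay` but for all
continuous fast `g` with `|g w| ≤ c⋆ (1 + ‖w‖²)`. -/
def QuadraticClassLdDecay : Prop :=
  ∀ (a θ : ℝ) (u₀ : Literature.MathematicalPhysics.KineticTheory.V3), 0 < a → 0 < θ → ∃ σ₀ : ℝ, 0 < σ₀ ∧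
    ∀ σ : ℝ, 0 < σ → σ < σ₀ →
    (∀ (N : ℕ) (Φ : Literature.Analysis.FluidPDE.HardSphereFlow (Literature.Analysis.FluidPDE.Torus.geometry (Fin 3))
        (Literature.MathematicalPhysics.KineticTheory.hsDiameter σ N) (N + 1)),
      MeasureTheory.IsProbabilityMeasure
        (Literature.MathematicalPhysics.KineticTheory.localGibbsLaw σ (fun _ => a) (fun _ => u₀) (fun _ => θ) N Φ)) ∧
    ∃ cstar : ℝ, 0 < cstar ∧
    ∀ (φ : Literature.MathematicalPhysics.KineticTheory.T3 → ℝ) (g : Literature.MathematicalPhysics.KineticTheory.V3 → ℝ),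
      Continuous φ → Continuous g → (∀ x, |φ x| ≤ 1) → (∀ v, |g v| ≤ cstar * (1 + ‖v‖ ^ 2)) →
      (∀ (c₀ c₂ : ℝ) (b : Literature.MathematicalPhysics.KineticTheory.V3),
        ∫ v, g v * (c₀ + inner ℝ b v + c₂ * ‖v‖ ^ 2) ∂(ProbabilityTheory.stdGaussian Literature.MathematicalPhysics.KineticTheory.V3) = 0) →
      ∀ δ : ℝ, 0 < δ → ∃ τ : ℝ, 0 < τ ∧ ∃ N₀ : ℕ, ∀ N : ℕ, N₀ ≤ N →
      ∀ Φ : Literature.Analysis.FluidPDE.HardSphereFlow (Literature.Analysis.FluidPDE.Torus.geometry (Fin 3))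
          (Literature.MathematicalPhysics.KineticTheory.hsDiameter σ N) (N + 1),
        ∫⁻ z, ENNReal.ofReal (Real.exp ((τ * ((N + 1 : ℕ) : ℝ) ^ (-(1 / 3 : ℝ)))⁻¹ *
            ∫ s in (0 : ℝ)..(τ * ((N + 1 : ℕ) : ℝ) ^ (-(1 / 3 : ℝ))),
              ∑ i, φ (Φ.flow s z i).1 * g ((Real.sqrt θ)⁻¹ • ((Φ.flow s z i).2 - u₀))))
          ∂(Literature.MathematicalPhysics.KineticTheory.localGibbsLaw σ (fun _ => a) (fun _ => u₀) (fun _ => θ) N Φ)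
        ≤ ENNReal.ofReal (Real.exp (δ * (N + 1)))

/-- **The amplitude ladder** (provable-grade glue of the line; M-sized): the bounded class (shared hypothesis
`KineticFluxLdDecay`, amplitude `κ`) and the rare half (`RareBandLdDecay`, amplitude `c⋆` beyond `V₁`) give the
quadratic class with constant `min(c⋆, κ / (2 (1 + V₁²)))`: split `g = g χ + g (1 - χ)` with a smooth cutoff `χ`
at `V₁`, re-orthogonalise both pieces to `span(1, w, ‖w‖²)` (the corrections are collision-invariant
polynomials with explicit small coefficients, whose window functionals are conserved-field functionals bounded by
Jensen-in-time + invariance of `G_N` + a static Gaussian computation), and apply Cauchy–Schwarz to the window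
exponential moment. -/
def AmplitudeLadder : Prop :=
  KineticFluxLdDecay → RareBandLdDecay → QuadraticClassLdDecay

/-- **Rare-band slaving** (the line's internal bet, stated as a Prop): the rare half is SLAVED to the
bounded class — given `KineticFluxLdDecay` (amplitude `κ` on bounded bulk observables), the band-supported
functional concentrates at LD precision around its bulk-conditional mean (fast packets are conditionally
independent Rayleigh particles over their residence time `≈ 4 ℓ_mf / V`), and that mean is a BOUNDED bulk
observable of sup `≲ c⋆ Σ_k 4^k e^{-4^k/2} ≤ 3 c⋆` (tail slaving + linear response), to which the bounded class
applies once `c⋆ ≲ κ`; the local-equilibrium (Galilean / temperature) response is a conserved-field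
functional, costed statically. -/
def RareBandSlaving : Prop :=
  KineticFluxLdDecay → RareBandLdDecay

/-- Sanity: the ladder is an implication between the three typed statements (unfolding). -/
theorem amplitudeLadder_iff :
    AmplitudeLadder ↔ (KineticFluxLdDecay → RareBandLdDecay → QuadraticClassLdDecay) := Iff.rfl

/-- With slaving, the quadratic class follows from the bounded class ALONE (pure logic on the two Props). -/
theorem quadraticClass_of_bounded (hS : RareBandSlaving) (hL : AmplitudeLadder) (hA : KineticFluxLdDecay) :
    QuadraticClassLdDecay :=
  hL hA (hS hA)

end Summit.AtomisticToContinuum.HydrodynamicLimit.Cruxes.KineticWindowGronwall.RareBandResidenceLadder
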